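import Summits.BirchSwinnertonDyer.BirchSwinnertonDyer.Theorems.ManinLocalTwoThreeKatoFactTwoAtPeriodRatio
import Summits.BirchSwinnertonDyer.Rank1Residual.ManinAdditive.GammaOneHalfHomothety
import HarnessLib

/-!
# The period-domination excuse of skeleton v20 BY NAME over the typer's es-g26 loci (`KatoCurve.OddSymbolClosureNeighbour`,
# `KatoCurve.TwoPowerHomothety`, `KatoCurve.HalfHomothety`; leaf `…ManinAdditive.GammaOneHalfHomothety`, typer g18 T-es-39)
# (route `ManinLocalTwoThree`, cell bsd-f2-manin; crux C2 stmt-BirchSwinnertonDyer-22967; LEAD seat p1 gen 13)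

THE POINT.  v17–v20's Kato stub excuses an optimal `X₁(N)`-datum `(V, D₁)` whenever some globally minimal symbol-closure curve `V′` of the class
satisfies `q·Ω(V′) = m·Ω(V)` with `q` odd («period-dominated», inline).  The typer has since landed es's NAMED loci.  This file records, by name:
`OddSymbolClosureNeighbour V D₁.f` ⟹ period-dominated (`periodDominated_of_oddSymbolClosureNeighbour`; odd isogenies are period-odd,
`exists_odd_realPeriod_ratio_of_oddIsogeny`), hence `TwoPowerHomothety D₁.f` / `HalfHomothety D₁.f` ⟹ period-dominated for OPTIMAL `D₁`
(`isSymbolClosureCurve_of_twoPowerHomothety`), and the law-level consequence: the typer's restricted stub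
`KatoNeronIntegralTwoGamma1OptimalOnOddNeighbour` is IMPLIED by F-es-21♭K alone (no S-es-g26-1 hypothesis: `katoNeronIntegralTwoGamma1OptimalOnOddNeighbour_of_symbolClosure`),
so every v20 Kato-stub instance on es's named loci is discharged by stub 7.  Nothing about BSD or Manin's conjecture is proved; no definitions, no sorry.
-/

set_option autoImplicit false
-- lint-debt: the directory name repeats the summit name (sibling precedent `ManinLocalTwoThreeGammaOneKatoRoad.lean`)
set_option linter.dupNamespace false

noncomputable section

open scoped Classical MatrixGroups ModularForm
open CongruenceSubgroup WeierstrassCurve Literature.NumberTheory.EllipticCurves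
  Literature.NumberTheory.EllipticCurves.ModularForms
  Summit.BirchSwinnertonDyer.Rank1Residual.ManinAdditive
  Summit.BirchSwinnertonDyer.Rank1Residual.ManinAdditive.KatoCurve

namespace Summit.BirchSwinnertonDyer.BirchSwinnertonDyer.Theorems.ManinLocalTwoThree

/-- **es's `OddSymbolClosureNeighbour V D₁.f` ⟹ `V` is period-dominated by a symbol-closure relative** (v20's excuse shape): an odd-degree
isogeny scales the real period by odd/odd. [cite: SilvermanAEC2009, Thm. VI.4.1(b) (shape only)] -/
theorem periodDominated_of_oddSymbolClosureNeighbour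
    (V : WeierstrassCurve ℚ) [V.IsElliptic] [V.IsGloballyMinimal] {N : ℕ} [NeZero N]
    (D₁ : Gamma1ParametrizationData V N) (h : OddSymbolClosureNeighbour V D₁.f) :
    ∃ (V' : WeierstrassCurve ℚ) (_ : V'.IsElliptic) (_ : V'.IsGloballyMinimal) (q m : ℤ),
      Odd q ∧ WeierstrassCurve.IsIsogenous V' V ∧ (q : ℝ) * V'.realPeriodRat = (m : ℝ) * V.realPeriodRat ∧
      IsSymbolClosureCurve V' D₁.f := by
  obtain ⟨V', hE, hM, ⟨ψ, hodd⟩, hsc⟩ := h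
  haveI := hE; haveI := hM
  exact exists_periodDominating_of_oddSymbolClosureNeighbour V D₁ ⟨V', hE, hM, ψ, hodd, hsc⟩

/-- **`TwoPowerHomothety D₁.f` (es's HH locus, `𝓛̄_f = 2^{−j}Λ₁(f)`) with `D₁` OPTIMAL ⟹ period-dominated** (the optimal curve is itself a
symbol-closure curve, `isSymbolClosureCurve_of_twoPowerHomothety`, and is its own odd neighbour). [cite: Wuthrich2014, §1 and §3] -/
theorem periodDominated_of_twoPowerHomothety
    (V : WeierstrassCurve ℚ) [V.IsElliptic] [V.IsGloballyMinimal] {N : ℕ} [NeZero N]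
    (D₁ : Gamma1ParametrizationData V N) (hopt : D₁.IsOptimal) (h : TwoPowerHomothety D₁.f) :
    ∃ (V' : WeierstrassCurve ℚ) (_ : V'.IsElliptic) (_ : V'.IsGloballyMinimal) (q m : ℤ),
      Odd q ∧ WeierstrassCurve.IsIsogenous V' V ∧ (q : ℝ) * V'.realPeriodRat = (m : ℝ) * V.realPeriodRat ∧
      IsSymbolClosureCurve V' D₁.f :=
  periodDominated_of_oddSymbolClosureNeighbour V D₁
    (oddSymbolClosureNeighbour_of_isSymbolClosureCurve V D₁.f (isSymbolClosureCurve_of_twoPowerHomothety D₁ hopt h))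

/-- **`HalfHomothety D₁.f` (`𝓛̄_f = ½Λ₁(f)`, 17/21 blind classes ≤ 5000) with `D₁` OPTIMAL ⟹ period-dominated.** [cite: Wuthrich2014, §1 and §3] -/
theorem periodDominated_of_halfHomothety
    (V : WeierstrassCurve ℚ) [V.IsElliptic] [V.IsGloballyMinimal] {N : ℕ} [NeZero N]
    (D₁ : Gamma1ParametrizationData V N) (hopt : D₁.IsOptimal) (h : HalfHomothety D₁.f) :
    ∃ (V' : WeierstrassCurve ℚ) (_ : V'.IsElliptic) (_ : V'.IsGloballyMinimal) (q m : ℤ),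
      Odd q ∧ WeierstrassCurve.IsIsogenous V' V ∧ (q : ℝ) * V'.realPeriodRat = (m : ℝ) * V.realPeriodRat ∧
      IsSymbolClosureCurve V' D₁.f :=
  periodDominated_of_twoPowerHomothety V D₁ hopt (twoPowerHomothety_of_half h)

/-- **The typer's restricted stub `KatoNeronIntegralTwoGamma1OptimalOnOddNeighbour` from F-es-21♭K ALONE** (no S-es-g26-1 hypothesis — p3's odd
transfer / the period-ratio transfer supply it at `4 ∣ N`… here with NO level hypothesis, via the period form: an odd neighbour is period-odd at any
level, and `katoFactTwoAt_of_isIsogenous_of_realPeriod_ratio` needs `4 ∣ N` only for additivity — so we state it at `4 ∣ N`). [cite: Kato2004Asterisque, Thm. 12.5 (1) (p. 221)] -/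
theorem katoFactTwoAt_of_oddSymbolClosureNeighbour_of_symbolClosure_of_four_dvd
    (hK : kato_isIntegral_twistedSymbolSum_two_symbolClosure)
    (V : WeierstrassCurve ℚ) [V.IsElliptic] [V.IsGloballyMinimal] {N : ℕ} [NeZero N] (h4 : 2 ^ 2 ∣ N)
    (D₁ : Gamma1ParametrizationData V N) (h : OddSymbolClosureNeighbour V D₁.f) : KatoFactTwoAt V D₁.f := by
  obtain ⟨V', i', i'', q, m, hq, hiso, hΩ, hsc⟩ := periodDominated_of_oddSymbolClosureNeighbour V D₁ h
  exact katoFactTwoAt_of_isIsogenous_of_realPeriod_ratio V V' D₁.f h4 hiso q m hq hΩ (hK V' D₁.f hsc)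

end Summit.BirchSwinnertonDyer.BirchSwinnertonDyer.Theorems.ManinLocalTwoThree

end
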